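import Summits.Schanuel.Schanuel.Theorems.RootDecomp1KSiegelFunctions06

/-!
# RootDecomp1KSiegelFunctions — lens 1, generation 71, NODE 31 «THE HEIGHT BINDER HALVED: `HeightComparison ⟸ SiegelFunctionsAll`, ARITHMETIC HALF PROVED» (×0-AS-RECORD + one contingent ×1 at FLOOR G (a) — PRICE 31 L3149, RULING L3160, NODE L3172, VERDICT L3175): the node-12 hypothesis binder `HeightComparison` (Weil–Siegel height comparison on a plane curve) is, definitionally, `∀ P, GeomIrreducible P → 1 ≤ xdeg P → 1 ≤ deg_Y P → HeightComparisonAt P`, and `heightComparisonAt_of_siegelFunctions` PROVES `HeightComparisonAt P` from the GEOMETRIC datum `SiegelFunctions P ∧ SiegelFunctions (swap P)` (two integral functions of controlled degree for every b ≥ 1); the ARITHMETIC half (rational-root integrality, archimedean root bound, `h(y^b) = b·h(y)`, finite exceptional fibres by Bezout, exchange of variables) is proved sorry-free; hence `heightComparison_of_siegelFunctionsAll : SiegelFunctionsAll → HeightComparison` and the node-12 heads re-pointed BY NAME; the geometric half `SiegelFunctionsAll` is a typed HYPOTHESIS (plan S1–S6 in the docstring of `SiegelFunctions`), NOT proved;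 (G)-instances by hand: `parabP` / its transpose / `hyperbP`, and the infinite family 𝒞₃ = {(x·Y − 1)² − f(x) : f cubic, f(0) ≠ 1} in BOTH charts (Lucas trace; the 3 × 3 POWER LEMMA), its geometric irreducibility, and the HYPOTHESIS-FREE `heightComparisonAt_sqLinP` / `thinFibreAt_two_sqLinP` — ×0-AS-RECORD toolkit per RULING L3160 (every 𝒞₃ member is also decided by the numerator lever); `PadicSubspace`, items 33364 / 33363 / 31077 / 31987 and the tally UNMOVED — continuation (RootDecomp1KSiegelFunctions07): §9  THE POWER LEMMA (integrality of powers, in coordinates): if `z` satisfies the monic cubic — 35 declarations `compM` … `natDegree_det3_compM_pow_le`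

(lens-1 g71 NODE 31 «THE HEIGHT BINDER HALVED» L3172: HOME kernel K = HOME/decomp-schanuel-lens-1/g71/lean/SiegelFunctions.lean sha256 4f39c136…, 1983 l, 207 decls (173 theorems + 34 defs by the critic's count, VERDICT L3175; NODE's «208» an e-lite), ONE namespace `Summit.Schanuel.Schanuel.Theorems.RootDecomp1KSiegelFunctions` (inner anonymous-free sections `PowerLemma` / `Chart2` / `GeomIrreducible` with their `variable`s kept whole inside one part each), imports EXACTLY the tree port …RootDecomp1KHeightGrading02 (node 12: `HeightComparison`, `HeightDecidedAt`, `GeomIrreducible`, `logHt` BY TREE NAME) + `Literature.NumberTheory.DiophantineGeometry.PlaneCurveBezoutWeak` + `Mathlib.RingTheory.Polynomial.RationalRoot`; no private / instance / set_option / notation / sorry / new axiom / native_decide / [cite; lens farm rc 0 · 0 errors · 0 sorries · dupNamespace warnings only; `#print axioms` = [propext, Classical.choice, Quot.sound] on the nine probed heads (g71/out/ax_*.json), Probe g71/out/ProbeK.lean 2659bdec… rc 0 (rfl pin `HeightComparison` = tree), CONTROLS A / A0 / B rc 1 as designed (ctrlA 4ae3a6d6… / ctrlA0 ff875685… / ctrlB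 f20add70…), memo g71/NODE-g71.md 07fb49f8…, SHA256SUMS 34 files; CLAIM 31 L3146; crit PRICE 31 L3149 (×0-as-record + one contingent ×1 at FLOOR G; CHECKLIST K-g71; RULES K-R59 / K-R60 pre-announced); lens ASK-FIRST FAMILY CLAIM L3158 (𝒞₃) and crit RULING L3160 (𝒞₃ REFUSED as a FLOOR-G (b) family: numerator lever, NUMEXP; toolkit ×0 under K-R60 (i)); census INSTRUMENT NOTES 54–56 L3161 / L3163 / L3167 (LIVENESS-v46 / v47 / v48: rows 75–77 = 𝒞₃ members, keys numexp / numexp_tight / k60) and crit ACKs L3165 / L3168; writer NOTES 4 / 5 L3162 / L3173; crit-1 (g13) VERDICT 31 L3175: «NODE 31 = ×0-AS-RECORD BOOKED; CHECKLIST K-g71 (J1)–(J7) MET; the contingent THEOREM ×1 REGISTERED under K-R59 (ii), UNPAID (FLOOR G unmet); RULES K-R59 and K-R60 (i)–(iv) FIXED; PORT GO» — kernel re-verified by the critic (farm rc 0 · 0 errors · 0 sorries; 207 decls = 173 theorems + 34 defs; axioms standard re-probed on 27 heads), record: piece C227 «HeightComparison ⟸ SiegelFunctionsAll», the K-line binder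 HeightComparison henceforth CONSUMED through heightComparison_of_siegelFunctionsAll (Dom re-pointing BY NAME, antecedent count unchanged), 𝒞₃ / InC3 decided hypothesis-free by thinFibreAt_of_inC3 / thinFibreAt_two_sqLinP = the K-R60 (i) kernel shape (TOOLKIT, ×0, never payable), tally UNCHANGED lens-1 ×22 + THEOREM ×24, EXHIBITS ρ1 / ρ2 VACANT, 33364 / 33363 / 31077 / 31987 OPEN rung 0. Port by census-1 gen 26 as `RootDecomp1KSiegelFunctions01–09` (files ≤ 400 lines; chain 01 ← the three K imports, 0k ← 0(k−1); `--supports stmt-Schanuel-33364`, the item stays OPEN; ×0 record port — the geometric binder `SiegelFunctions` / `SiegelFunctionsAll` appears ONLY as an explicit hypothesis of the `…_of_siegelFunctions…` heads, never an axiom / instance / variable; no credit anywhere; the section-aligned 9-part split is lens-1's port plan (J7) re-built by the census pipeline): 01 = K-port l.1–216 (§0 / §1) — 25 decls `ratModel`, `QDvd`, `relPoly`, …, `evalEval_ratModel_relPoly`; 02 = K-port l.219–450 (§2) — 20 decls `scaledEval`, `l1`, `l1_nonneg`, …, `abs_le_of_rel`; 03 = K-port l.453–658 (§3 / §4) — 9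 decls `HtQ_pow`, `logHt_pow`, `HtQ_intDiv_le`, …, `upperComparisonAt_of_siegelFunctions`; 04 = K-port l.661–830 (§5) — 13 decls `coeff_coeff_swap`, `map_swap`, `natDegree_swap`, …, `heightComparison_of_siegelFunctions`; 05 = K-port l.833–1109 (§6 / §7) — 28 decls `thinFibreAt_of_heightComparisonAt`, `thinFibreAt_of_heightComparison'`, `thinFibreAt_of_siegelFunctions`, …, `siegelFunctions_toys`; 06 = K-port l.1111–1304 (§8) — 20 decls `sqLinP`, `sqLinP_eq`, `natDegree_sqLinP`, …, `thinFibreAt_sqLinP_of_swap`; 07 = K-port l.1306–1551 (§9) — 35 decls `compM`, `cubic`, `cubic_eq`, …, `natDegree_det3_compM_pow_le`; 08 = K-port l.1553–1860 (§10) — 40 decls `q₃`, `q₂`, `q₁`, …, `heightComparisonAt_sqLinP_of_geomIrreducible`; 09 = K-port l.1862–2078 (§11 / §12) — 17 decls `sqLinK`, `coeff_sqLinK`, `natDegree_sqLinK`, …, `thinFibreAt_of_inC3`. 91 one-line docstrings synthesised for undocumented helper declarations (statements quoted); TWO port-side modifiers of record: `sum_Icc_half_pow` (§2, part 02) is `private`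 with a PORT NOTE after the `dedup.landed` bounce p850627 (≡ `Literature.Computability.Cryptography.HashDom.sum_Icc_half_pow`), and the consistency check `thinFibreAt_of_heightComparison'` (§6, part 05) is `private` with a PORT NOTE after the `dedup.landed` bounce p850703 (≡ node 12's `RootDecomp1KHeightGrading.thinFibreAt_of_heightComparison`, the intended identity); everything else = K VERBATIM (statements, names, proofs, K's module docstring kept in part 01 below this provenance block).)
-/

noncomputable section

namespace Summit.Schanuel.Schanuel.Theorems.RootDecomp1KSiegelFunctions

open Polynomial
open scoped Nat
open Summit.Schanuel.Schanuel.Theorems.RootDecomp1KDegreeLadder (bev xdeg natDegree_coeff_le_xdeg ThinFibreAt ThinFibre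
  thinFibreAt_of_natDegree_lt)
open Summit.Schanuel.Schanuel.Theorems.RootDecomp1KHeightGrading

/-! ### §9  THE POWER LEMMA (integrality of powers, in coordinates): if `z` satisfies the monic cubic
`S³ − e₁S² + e₂S − e₃` over `ℤ[x]` with `deg e_i ≤ a₀·i`, then `z^e` satisfies `T³ − t·T² + s·T − d` with
`(t, s, d) = (tr, c₂, det)(M^e)`, `M` the companion matrix, and `deg t ≤ a₀e`, `deg s ≤ 2a₀e`, `deg d ≤ 3a₀e`
(Cayley–Hamilton for `M^e`, division by the monic cubic via the cyclic vector, and the trace recursions for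
`tr(M^e)`, `c₂(M^e) = tr(adj(M)^e)`, `det(M^e) = e₃^e`).  This is step S5 of (G) for cubic charts, made explicit. -/

section PowerLemma

variable {A : Type*} [CommRing A]

/-- the companion matrix of `S³ − e₁S² + e₂S − e₃` on the basis `1, S, S²`. -/
def compM (e₁ e₂ e₃ : A) : Matrix (Fin 3) (Fin 3) A := !![0, 0, e₃; 1, 0, -e₂; 0, 1, e₁]

/-- the monic cubic `S³ − e₁S² + e₂S − e₃`. -/
noncomputable def cubic (e₁ e₂ e₃ : A) : A[X] := C 1 * X ^ 3 + C (-e₁) * X ^ 2 + C e₂ * X + C (-e₃)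

/-- `(e₁ e₂ e₃ : A) : cubic e₁ e₂ e₃ = X ^ 3 - C e₁ * X ^ 2 + C e₂ * X - C e₃`. -/
theorem cubic_eq (e₁ e₂ e₃ : A) : cubic e₁ e₂ e₃ = X ^ 3 - C e₁ * X ^ 2 + C e₂ * X - C e₃ := by
  simp only [cubic, map_one, one_mul, map_neg, neg_mul]; ring

/-- `[Nontrivial A] (e₁ e₂ e₃ : A) : (cubic e₁ e₂ e₃).Monic`. -/
theorem monic_cubic [Nontrivial A] (e₁ e₂ e₃ : A) : (cubic e₁ e₂ e₃).Monic := by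
  unfold Polynomial.Monic cubic; exact leadingCoeff_cubic one_ne_zero

/-- `[Nontrivial A] (e₁ e₂ e₃ : A) : (cubic e₁ e₂ e₃).degree = 3`. -/
theorem degree_cubic_eq [Nontrivial A] (e₁ e₂ e₃ : A) : (cubic e₁ e₂ e₃).degree = 3 := by
  unfold cubic; exact degree_cubic one_ne_zero

/-- trace, second coefficient and determinant of a `3 × 3` matrix, written out. -/
def tr3 (N : Matrix (Fin 3) (Fin 3) A) : A := N 0 0 + N 1 1 + N 2 2

/-- the sum of the principal `2 × 2` minors. -/
def c23 (N : Matrix (Fin 3) (Fin 3) A) : A :=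
  N 0 0 * N 1 1 - N 0 1 * N 1 0 + (N 0 0 * N 2 2 - N 0 2 * N 2 0) + (N 1 1 * N 2 2 - N 1 2 * N 2 1)

/-- the determinant, written out. -/
def det3 (N : Matrix (Fin 3) (Fin 3) A) : A :=
  N 0 0 * N 1 1 * N 2 2 - N 0 0 * N 1 2 * N 2 1 - N 0 1 * N 1 0 * N 2 2 + N 0 1 * N 1 2 * N 2 0 +
    N 0 2 * N 1 0 * N 2 1 - N 0 2 * N 1 1 * N 2 0

/-- **Cayley–Hamilton for `3 × 3` matrices**, with the coefficients written out. -/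
theorem cayleyHamilton3 (N : Matrix (Fin 3) (Fin 3) A) :
    N ^ 3 - tr3 N • N ^ 2 + c23 N • N - det3 N • (1 : Matrix (Fin 3) (Fin 3) A) = 0 := by
  ext i j
  fin_cases i <;> fin_cases j <;>
    simp [pow_succ, Matrix.mul_apply, Fin.sum_univ_three, tr3, c23, det3] <;> ring

/-- `(N : Matrix (Fin 3) (Fin 3) A) (n₁ n₂ n₃ : ℕ) (t s d : A) : aeval N (X ^ n₁ - C t * X ^ n₂ + C s * X ^ n₃ - C d) = N ^ n₁ - t • N ^ n₂ + s • N ^ n₃ - d • 1`. -/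
theorem aeval_eq_smul (N : Matrix (Fin 3) (Fin 3) A) (n₁ n₂ n₃ : ℕ) (t s d : A) :
    aeval N (X ^ n₁ - C t * X ^ n₂ + C s * X ^ n₃ - C d) = N ^ n₁ - t • N ^ n₂ + s • N ^ n₃ - d • 1 := by
  simp [Algebra.algebraMap_eq_smul_one]

/-- `(e₁ e₂ e₃ : A) : tr3 (compM e₁ e₂ e₃) = e₁`. -/
theorem tr3_compM (e₁ e₂ e₃ : A) : tr3 (compM e₁ e₂ e₃) = e₁ := by simp [tr3, compM]
/-- `(e₁ e₂ e₃ : A) : c23 (compM e₁ e₂ e₃) = e₂`. -/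
theorem c23_compM (e₁ e₂ e₃ : A) : c23 (compM e₁ e₂ e₃) = e₂ := by simp [c23, compM]
/-- `(e₁ e₂ e₃ : A) : det3 (compM e₁ e₂ e₃) = e₃`. -/
theorem det3_compM (e₁ e₂ e₃ : A) : det3 (compM e₁ e₂ e₃) = e₃ := by simp [det3, compM]

/-- `(e₁ e₂ e₃ : A) : aeval (compM e₁ e₂ e₃) (cubic e₁ e₂ e₃) = 0`. -/
theorem aeval_compM_cubic (e₁ e₂ e₃ : A) : aeval (compM e₁ e₂ e₃) (cubic e₁ e₂ e₃) = 0 := by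
  have h := cayleyHamilton3 (compM e₁ e₂ e₃)
  rw [tr3_compM, c23_compM, det3_compM] at h
  have e : aeval (compM e₁ e₂ e₃) (cubic e₁ e₂ e₃) =
      compM e₁ e₂ e₃ ^ 3 - e₁ • compM e₁ e₂ e₃ ^ 2 + e₂ • compM e₁ e₂ e₃ - e₃ • 1 := by
    simp [cubic_eq, Algebra.algebraMap_eq_smul_one]
  rw [e, h]

/-- the first column of `c₀·1 + c₁·M + c₂·M²` is `(c₀, c₁, c₂)` (cyclic vector `e₀`). -/
theorem compM_col (e₁ e₂ e₃ c₀ c₁ c₂ : A) :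
    (c₀ • (1 : Matrix (Fin 3) (Fin 3) A) + c₁ • compM e₁ e₂ e₃ + c₂ • compM e₁ e₂ e₃ ^ 2) 0 0 = c₀ ∧
    (c₀ • (1 : Matrix (Fin 3) (Fin 3) A) + c₁ • compM e₁ e₂ e₃ + c₂ • compM e₁ e₂ e₃ ^ 2) 1 0 = c₁ ∧
    (c₀ • (1 : Matrix (Fin 3) (Fin 3) A) + c₁ • compM e₁ e₂ e₃ + c₂ • compM e₁ e₂ e₃ ^ 2) 2 0 = c₂ := by
  refine ⟨?_, ?_, ?_⟩ <;> simp [compM, pow_succ]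

/-- division by the monic cubic: a polynomial killed by the companion matrix is a multiple of the cubic. -/
theorem cubic_dvd_of_aeval_eq_zero [Nontrivial A] {e₁ e₂ e₃ : A} {g : A[X]}
    (hg : aeval (compM e₁ e₂ e₃) g = 0) : cubic e₁ e₂ e₃ ∣ g := by
  have hμ := monic_cubic e₁ e₂ e₃
  rw [← modByMonic_eq_zero_iff_dvd hμ]
  set r := g %ₘ cubic e₁ e₂ e₃ with hr_def
  have hdeg : r.degree < 3 := by
    have := degree_modByMonic_lt g hμ; rwa [degree_cubic_eq] at this
  have hr : aeval (compM e₁ e₂ e₃) r = 0 := by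
    have e := modByMonic_add_div g (cubic e₁ e₂ e₃)
    have : aeval (compM e₁ e₂ e₃) g =
        aeval (compM e₁ e₂ e₃) r + aeval (compM e₁ e₂ e₃) (cubic e₁ e₂ e₃) *
          aeval (compM e₁ e₂ e₃) (g /ₘ cubic e₁ e₂ e₃) := by
      rw [← map_mul, ← map_add, e]
    rw [hg, aeval_compM_cubic, zero_mul, add_zero] at this
    exact this.symm
  have hc : ∀ k, 3 ≤ k → r.coeff k = 0 := fun k hk =>
    coeff_eq_zero_of_degree_lt (hdeg.trans_le (by exact_mod_cast hk))
  obtain ⟨c₀, c₁, c₂, hr3⟩ : ∃ c₀ c₁ c₂ : A, r = C c₀ + C c₁ * X + C c₂ * X ^ 2 := by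
    refine ⟨r.coeff 0, r.coeff 1, r.coeff 2, ?_⟩
    ext k
    simp only [coeff_add, coeff_C_mul, coeff_X_pow, coeff_C, coeff_X]
    rcases Nat.lt_or_ge k 3 with h | h
    · interval_cases k <;> simp
    · simp [hc k h, show k ≠ 0 by omega, show k ≠ 2 by omega, show (1 : ℕ) ≠ k by omega]
  rw [hr3] at hr
  have e : aeval (compM e₁ e₂ e₃) (C c₀ + C c₁ * X + C c₂ * X ^ 2) =
      c₀ • (1 : Matrix (Fin 3) (Fin 3) A) + c₁ • compM e₁ e₂ e₃ + c₂ • compM e₁ e₂ e₃ ^ 2 := by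
    simp [Algebra.algebraMap_eq_smul_one]
  rw [e] at hr
  obtain ⟨h0, h1, h2⟩ := compM_col e₁ e₂ e₃ c₀ c₁ c₂
  rw [hr] at h0 h1 h2
  simp only [Matrix.zero_apply] at h0 h1 h2
  rw [hr3, ← h0, ← h1, ← h2]; simp

/-- the power relation `ρ_e(S) := S^{3e} − tr(M^e)·S^{2e} + c₂(M^e)·S^e − det(M^e)`. -/
noncomputable def powRel (e₁ e₂ e₃ : A) (e : ℕ) : A[X] :=
  X ^ (3 * e) - C (tr3 (compM e₁ e₂ e₃ ^ e)) * X ^ (2 * e) + C (c23 (compM e₁ e₂ e₃ ^ e)) * X ^ e -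
    C (det3 (compM e₁ e₂ e₃ ^ e))

/-- **THE POWER LEMMA (divisibility half)**: the monic cubic divides `ρ_e(S)` — so every root `z` of the cubic
(in any algebra) has `z^e` a root of `T³ − tr(M^e)T² + c₂(M^e)T − det(M^e)`. -/
theorem cubic_dvd_powRel [Nontrivial A] (e₁ e₂ e₃ : A) (e : ℕ) : cubic e₁ e₂ e₃ ∣ powRel e₁ e₂ e₃ e := by
  apply cubic_dvd_of_aeval_eq_zero
  rw [powRel, aeval_eq_smul, pow_mul', pow_mul']
  exact cayleyHamilton3 (compM e₁ e₂ e₃ ^ e)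

/-! Degrees via trace recursions (`A = ℤ[x]`): `t_e = tr(M^e)` and `s_e = c₂(M^e) = tr(adj(M)^e)` satisfy the
Newton-type recursion `u_{n+3} = tr K·u_{n+2} − c₂ K·u_{n+1} + det K·u_n` (`K = M`, resp. `K = adj M`), and
`d_e = det(M)^e = e₃^e`. -/

/-- `(N N' : Matrix (Fin 3) (Fin 3) A) : tr3 (N + N') = tr3 N + tr3 N'`. -/
theorem tr3_add (N N' : Matrix (Fin 3) (Fin 3) A) : tr3 (N + N') = tr3 N + tr3 N' := by
  simp only [tr3, Matrix.add_apply]; ring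

/-- `(N N' : Matrix (Fin 3) (Fin 3) A) : tr3 (N - N') = tr3 N - tr3 N'`. -/
theorem tr3_sub (N N' : Matrix (Fin 3) (Fin 3) A) : tr3 (N - N') = tr3 N - tr3 N' := by
  simp only [tr3, Matrix.sub_apply]; ring

/-- `(a : A) (N : Matrix (Fin 3) (Fin 3) A) : tr3 (a • N) = a * tr3 N`. -/
theorem tr3_smul (a : A) (N : Matrix (Fin 3) (Fin 3) A) : tr3 (a • N) = a * tr3 N := by
  simp only [tr3, Matrix.smul_apply, smul_eq_mul]; ring

/-- `: tr3 (1 : Matrix (Fin 3) (Fin 3) A) = 3`. -/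
theorem tr3_one : tr3 (1 : Matrix (Fin 3) (Fin 3) A) = 3 := by
  simp [tr3]; norm_num

/-- the trace recursion from Cayley–Hamilton. -/
theorem tr3_pow_add_three (K : Matrix (Fin 3) (Fin 3) A) (n : ℕ) :
    tr3 (K ^ (n + 3)) = tr3 K * tr3 (K ^ (n + 2)) - c23 K * tr3 (K ^ (n + 1)) + det3 K * tr3 (K ^ n) := by
  have h := cayleyHamilton3 K
  have h3 : K ^ 3 = tr3 K • K ^ 2 - c23 K • K + det3 K • (1 : Matrix (Fin 3) (Fin 3) A) := by
    calc K ^ 3 = (K ^ 3 - tr3 K • K ^ 2 + c23 K • K - det3 K • (1 : Matrix (Fin 3) (Fin 3) A)) +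
          (tr3 K • K ^ 2 - c23 K • K + det3 K • (1 : Matrix (Fin 3) (Fin 3) A)) := by abel
      _ = _ := by rw [h, zero_add]
  have e : K ^ (n + 3) = tr3 K • K ^ (n + 2) - c23 K • K ^ (n + 1) + det3 K • K ^ n := by
    rw [pow_add, h3, mul_add, mul_sub, mul_smul_comm, mul_smul_comm, mul_smul_comm, ← pow_add, ← pow_succ,
      mul_one]
  rw [e, tr3_add, tr3_sub, tr3_smul, tr3_smul, tr3_smul]

/-- `(N : Matrix (Fin 3) (Fin 3) A) : c23 N = tr3 (Matrix.adjugate N)`. -/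
theorem c23_eq_tr3_adjugate (N : Matrix (Fin 3) (Fin 3) A) : c23 N = tr3 (Matrix.adjugate N) := by
  rw [Matrix.adjugate_fin_three]; simp [c23, tr3]; ring

/-- `(N : Matrix (Fin 3) (Fin 3) A) : det3 N = N.det`. -/
theorem det3_eq_det (N : Matrix (Fin 3) (Fin 3) A) : det3 N = N.det := by
  rw [Matrix.det_fin_three, det3]

/-- degree growth along the trace recursion. -/
theorem natDegree_tr3_pow_le (K : Matrix (Fin 3) (Fin 3) ℤ[X]) (w : ℕ) (h1 : (tr3 K).natDegree ≤ w)
    (h2 : (c23 K).natDegree ≤ 2 * w) (h3 : (det3 K).natDegree ≤ 3 * w)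
    (h02 : (tr3 (K ^ 2)).natDegree ≤ 2 * w) : ∀ n, (tr3 (K ^ n)).natDegree ≤ w * n := by
  have key : ∀ n, (tr3 (K ^ n)).natDegree ≤ w * n ∧ (tr3 (K ^ (n + 1))).natDegree ≤ w * (n + 1) ∧
      (tr3 (K ^ (n + 2))).natDegree ≤ w * (n + 2) := by
    intro n
    induction n with
    | zero =>
        refine ⟨?_, ?_, ?_⟩
        · rw [pow_zero, tr3_one]
          have : ((3 : ℤ[X])).natDegree = 0 := by simp
          rw [this]; exact Nat.zero_le _
        · rw [zero_add, pow_one, mul_one]; exact h1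
        · rw [zero_add]; linarith
    | succ n ih =>
        obtain ⟨ha, hb, hc⟩ := ih
        refine ⟨hb, by rw [show n + 1 + 1 = n + 2 from rfl]; exact hc, ?_⟩
        rw [show n + 1 + 2 = n + 3 from rfl, tr3_pow_add_three]
        have e1 : w + w * (n + 2) = w * (n + 3) := by ring
        have e2 : 2 * w + w * (n + 1) = w * (n + 3) := by ring
        have e3 : 3 * w + w * n = w * (n + 3) := by ring
        refine natDegree_add_le_of_degree_le (natDegree_sub_le_of_le ?_ ?_ |>.trans (max_le le_rfl le_rfl)) ?_
        · exact (natDegree_mul_le_of_le h1 hc).trans e1.le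
        · exact (natDegree_mul_le_of_le h2 hb).trans e2.le
        · exact (natDegree_mul_le_of_le h3 ha).trans e3.le
  exact fun n => (key n).1

variable {e₁ e₂ e₃ : ℤ[X]} {a₀ : ℕ}

/-- `(e₁ e₂ e₃ : A) : tr3 (compM e₁ e₂ e₃ ^ 2) = e₁ ^ 2 - 2 * e₂`. -/
theorem tr3_compM_sq (e₁ e₂ e₃ : A) : tr3 (compM e₁ e₂ e₃ ^ 2) = e₁ ^ 2 - 2 * e₂ := by
  simp [tr3, compM, pow_two, Matrix.mul_apply, Fin.sum_univ_three]; ring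

/-- `(e₁ e₂ e₃ : A) : Matrix.adjugate (compM e₁ e₂ e₃) = !![e₂, e₃, 0; -e₁, 0, e₃; 1, 0, 0]`. -/
theorem adjugate_compM (e₁ e₂ e₃ : A) :
    Matrix.adjugate (compM e₁ e₂ e₃) = !![e₂, e₃, 0; -e₁, 0, e₃; 1, 0, 0] := by
  rw [compM, Matrix.adjugate_fin_three]
  ext i j; fin_cases i <;> fin_cases j <;> simp

/-- `(e₁ e₂ e₃ : A) : tr3 (Matrix.adjugate (compM e₁ e₂ e₃)) = e₂`. -/
theorem tr3_adjM (e₁ e₂ e₃ : A) : tr3 (Matrix.adjugate (compM e₁ e₂ e₃)) = e₂ := by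
  rw [adjugate_compM]; simp [tr3]

/-- `(e₁ e₂ e₃ : A) : c23 (Matrix.adjugate (compM e₁ e₂ e₃)) = e₁ * e₃`. -/
theorem c23_adjM (e₁ e₂ e₃ : A) : c23 (Matrix.adjugate (compM e₁ e₂ e₃)) = e₁ * e₃ := by
  rw [adjugate_compM]; simp [c23]; ring

/-- `(e₁ e₂ e₃ : A) : det3 (Matrix.adjugate (compM e₁ e₂ e₃)) = e₃ ^ 2`. -/
theorem det3_adjM (e₁ e₂ e₃ : A) : det3 (Matrix.adjugate (compM e₁ e₂ e₃)) = e₃ ^ 2 := by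
  rw [adjugate_compM]; simp [det3]; ring

/-- `(e₁ e₂ e₃ : A) : tr3 (Matrix.adjugate (compM e₁ e₂ e₃) ^ 2) = e₂ ^ 2 - 2 * (e₁ * e₃)`. -/
theorem tr3_adjM_sq (e₁ e₂ e₃ : A) : tr3 (Matrix.adjugate (compM e₁ e₂ e₃) ^ 2) = e₂ ^ 2 - 2 * (e₁ * e₃) := by
  rw [adjugate_compM]; simp [tr3, pow_two, Matrix.mul_apply, Fin.sum_univ_three]; ring

/-- **THE POWER LEMMA (degree half)**, trace: `deg tr(M^e) ≤ a₀·e`. -/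
theorem natDegree_tr3_compM_pow_le (h₁ : e₁.natDegree ≤ a₀) (h₂ : e₂.natDegree ≤ 2 * a₀)
    (h₃ : e₃.natDegree ≤ 3 * a₀) (e : ℕ) : (tr3 (compM e₁ e₂ e₃ ^ e)).natDegree ≤ a₀ * e := by
  refine natDegree_tr3_pow_le _ a₀ (by rwa [tr3_compM]) (by rwa [c23_compM]) (by rwa [det3_compM]) ?_ e
  rw [tr3_compM_sq]
  refine natDegree_sub_le_of_le (natDegree_pow_le.trans (by omega)) ?_ |>.trans (max_le le_rfl le_rfl)
  exact (natDegree_mul_le (p := (2 : ℤ[X]))).trans (by simp; omega)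

/-- **THE POWER LEMMA (degree half)**, second coefficient: `deg c₂(M^e) ≤ 2a₀·e`. -/
theorem natDegree_c23_compM_pow_le (h₁ : e₁.natDegree ≤ a₀) (h₂ : e₂.natDegree ≤ 2 * a₀)
    (h₃ : e₃.natDegree ≤ 3 * a₀) (e : ℕ) : (c23 (compM e₁ e₂ e₃ ^ e)).natDegree ≤ 2 * a₀ * e := by
  rw [c23_eq_tr3_adjugate, Matrix.adjugate_pow, show 2 * a₀ * e = (2 * a₀) * e from rfl]
  refine natDegree_tr3_pow_le _ (2 * a₀) (by rwa [tr3_adjM]) ?_ ?_ ?_ e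
  · rw [c23_adjM]; exact (natDegree_mul_le_of_le h₁ h₃).trans (by omega)
  · rw [det3_adjM]; exact natDegree_pow_le.trans (by omega)
  · rw [tr3_adjM_sq]
    refine natDegree_sub_le_of_le (natDegree_pow_le.trans (by omega)) ?_ |>.trans (max_le le_rfl le_rfl)
    exact (natDegree_mul_le (p := (2 : ℤ[X]))).trans
      (by simp; exact (natDegree_mul_le_of_le h₁ h₃).trans (by omega))

/-- **THE POWER LEMMA (degree half)**, determinant: `deg det(M^e) ≤ 3a₀·e`. -/
theorem natDegree_det3_compM_pow_le (h₃ : e₃.natDegree ≤ 3 * a₀) (e : ℕ) :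
    (det3 (compM e₁ e₂ e₃ ^ e)).natDegree ≤ 3 * a₀ * e := by
  rw [det3_eq_det, Matrix.det_pow, ← det3_eq_det, det3_compM]
  exact natDegree_pow_le.trans (by rw [mul_comm (3 * a₀) e]; exact Nat.mul_le_mul_left e h₃)

end PowerLemma

end Summit.Schanuel.Schanuel.Theorems.RootDecomp1KSiegelFunctions
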